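import Summits.AtomisticToContinuum.BoseEinsteinCondensation.Theorems.HealingPivotCascadeEngineCore
import Summits.AtomisticToContinuum.BoseEinsteinCondensation.Theses.HealingPivotCascade
import Literature.MathematicalPhysics.QuantumManyBody.BoseGasThermodynamicLimitRuelle

/-!
# Route HealingPivotCascade — the cascade engine (support item `CascadeEngine`, stmt-AtomisticToContinuum-32061), the
assembly (stmt-AtomisticToContinuum-32062) and the necessity / exactness links of the node

decomp-a2c lens-6 g9.  Proves BY NAME `cascadeEngine_holds : CascadeEngine` (floor at the healing pivot + retention cap
+ two-sided geometric domination of the relative coherent-sum loss at one density ⇒ `HasGroundStateBEC v ρ`) and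
`assembly_holds : Assembly`; the deciding theorem with the engine discharged (`closes_kernel`); the unconditional
NECESSITY of both cruxes (`retentionCap_of_bec`, `infraredDomination_of_bec`, escape disjunct) and the EXACTNESS
`bec_iff_node : DiluteFloor → (BoseEinsteinCondensation ↔ RetentionCap ∧ InfraredDomination)`. [elementary]
-/

noncomputable section

namespace Summit.AtomisticToContinuum.BoseEinsteinCondensation.Theorems.HealingPivotCascadeCascadeEngine

open scoped BigOperators Topology MeasureTheory ComplexConjugate ENNReal NNReal
open Filter Set MeasureTheory
open Summit.AtomisticToContinuum.BoseEinsteinCondensation.Theses.HealingPivotCascade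
open Summit.AtomisticToContinuum.BoseEinsteinCondensation.Theorems.HealingPivotCascadeEngineCore

section Shorthands
open Literature.MathematicalPhysics.QuantumManyBody.BoseGas

/-- The escape disjunct: outright macroscopic occupation. -/
def EscapeAt (v : ℝ → ENNReal) (ρ : ℝ) : Prop :=
  ∃ c₀ : ℝ, 0 < c₀ ∧ ∀ᶠ N : ℕ in Filter.atTop, ∃ δ : ENNReal, 0 < δ ∧
    ∀ Ψ : TrialState N (sideLength ρ N), energy v Ψ ≤ groundStateEnergy v N (sideLength ρ N) + δ →
      ENNReal.ofReal (c₀ * N) ≤ maxOccupation N Ψ.ψ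

/-- The 7/8 floor at the healing pivot (`M = 1`), as the engine consumes it. -/
def FloorAt (v : ℝ → ENNReal) (ρ : ℝ) : Prop :=
  ∀ᶠ N : ℕ in Filter.atTop, ∀ Ψ : TrialState N (sideLength ρ N),
    energy v Ψ ≤ groundStateEnergy v N (sideLength ρ N) + 1 →
      ∀ K : ℕ, 1 / Real.sqrt ρ ≤ sideLength ρ N / 2 ^ K → sideLength ρ N / 2 ^ K < 2 * (1 / Real.sqrt ρ) →
        ENNReal.ofReal (7 * (N : ℝ) / 8) ≤ subSum N (sideLength ρ N) K Ψ.ψ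

/-- B at one density. -/
def CapAt (v : ℝ → ENNReal) (ρ : ℝ) : Prop :=
  ∃ x : ℝ, 0 < x ∧ x < 1 ∧ ∃ c₀ : ℝ, 0 < c₀ ∧ ∀ θ : ℝ, 0 < θ → ∀ᶠ N : ℕ in Filter.atTop, ∃ δ : ENNReal, 0 < δ ∧
    ∀ Ψ : TrialState N (sideLength ρ N), energy v Ψ ≤ groundStateEnergy v N (sideLength ρ N) + δ →
      ENNReal.ofReal (c₀ * N) ≤ maxOccupation N Ψ.ψ ∨
        ∀ k : ℕ, 1 ≤ k → ENNReal.ofReal (θ * N) ≤ subSum N (sideLength ρ N) k Ψ.ψ →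
          ENNReal.ofReal (1 - x) * subSum N (sideLength ρ N) k Ψ.ψ ≤ subSum N (sideLength ρ N) (k - 1) Ψ.ψ

/-- A at one density. -/
def DomAt (v : ℝ → ENNReal) (ρ : ℝ) : Prop :=
  ∃ A : ℝ, 0 < A ∧ ∃ q : ℝ, 0 < q ∧ q < 1 ∧ ∃ c₀ : ℝ, 0 < c₀ ∧ ∀ᶠ N : ℕ in Filter.atTop, ∃ δ : ENNReal, 0 < δ ∧
    ∀ Ψ : TrialState N (sideLength ρ N), energy v Ψ ≤ groundStateEnergy v N (sideLength ρ N) + δ →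
      ENNReal.ofReal (c₀ * N) ≤ maxOccupation N Ψ.ψ ∨
        ∀ K k : ℕ, 1 / Real.sqrt ρ ≤ sideLength ρ N / 2 ^ K → sideLength ρ N / 2 ^ K < 2 * (1 / Real.sqrt ρ) →
          1 ≤ k → k ≤ K →
            subSum N (sideLength ρ N) k Ψ.ψ ≤ subSum N (sideLength ρ N) (k - 1) Ψ.ψ +
              ENNReal.ofReal (A * (q ^ (K - k) + q ^ k)) * subSum N (sideLength ρ N) k Ψ.ψ

/-- Item `DiluteFloor` ↔ its shorthand form (definitional). -/
theorem diluteFloor_iff :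
    DiluteFloor ↔ ∀ v : ℝ → ENNReal, IsRepulsiveFiniteRange v → ∀ M : ℝ, 0 < M →
      ∃ ρ₀ : ℝ, 0 < ρ₀ ∧ ∀ ρ : ℝ, 0 < ρ → ρ < ρ₀ →
        ∀ᶠ N : ℕ in atTop, ∀ Ψ : TrialState N (sideLength ρ N),
          energy v Ψ ≤ groundStateEnergy v N (sideLength ρ N) + 1 →
            ∀ k : ℕ, M / Real.sqrt ρ ≤ sideLength ρ N / 2 ^ k → sideLength ρ N / 2 ^ k < 2 * (M / Real.sqrt ρ) →
              ENNReal.ofReal (7 * (N : ℝ) / 8) ≤ subSum N (sideLength ρ N) k Ψ.ψ := Iff.rfl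

/-- Item `InfraredDomination` ↔ `∀ v, … → DomAt v ρ` (definitional). -/
theorem infraredDomination_iff :
    InfraredDomination ↔ ∀ v : ℝ → ENNReal, IsRepulsiveFiniteRange v →
      ∃ ρ₀ : ℝ, 0 < ρ₀ ∧ ∀ ρ : ℝ, 0 < ρ → ρ < ρ₀ → DomAt v ρ := Iff.rfl

/-- Item `RetentionCap` ↔ `∀ v, … → CapAt v ρ` (definitional). -/
theorem retentionCap_iff :
    RetentionCap ↔ ∀ v : ℝ → ENNReal, IsRepulsiveFiniteRange v →
      ∃ ρ₀ : ℝ, 0 < ρ₀ ∧ ∀ ρ : ℝ, 0 < ρ → ρ < ρ₀ → CapAt v ρ := Iff.rfl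

/-- Item `CascadeEngine` ↔ `FloorAt → CapAt → DomAt → HasGroundStateBEC` (definitional). -/
theorem cascadeEngine_iff :
    CascadeEngine ↔ ∀ v : ℝ → ENNReal, ∀ ρ : ℝ, 0 < ρ → FloorAt v ρ → CapAt v ρ → DomAt v ρ →
      HasGroundStateBEC v ρ := Iff.rfl

end Shorthands

section Sufficiency
open Literature.MathematicalPhysics.QuantumManyBody.BoseGas


/-- A healing pivot level exists once `L ≥ 1/√ρ`. -/
theorem exists_pivot {ρ L : ℝ} (hρ : 0 < ρ) (hL : 1 / Real.sqrt ρ ≤ L) :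
    ∃ K : ℕ, 1 / Real.sqrt ρ ≤ L / 2 ^ K ∧ L / 2 ^ K < 2 * (1 / Real.sqrt ρ) := by
  have hsr : 0 < Real.sqrt ρ := Real.sqrt_pos.2 hρ
  have hx : 1 ≤ L * Real.sqrt ρ := by
    rw [div_le_iff₀ hsr] at hL; exact hL
  obtain ⟨K, hK1, hK2⟩ := exists_nat_pow_near hx one_lt_two
  refine ⟨K, ?_, ?_⟩
  · rw [div_le_div_iff₀ hsr (by positivity)]
    linarith
  · rw [div_lt_iff₀ (by positivity : (0 : ℝ) < 2 ^ K)]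
    have : L < 2 ^ (K + 1) / Real.sqrt ρ := by rw [lt_div_iff₀ hsr]; exact hK2
    calc L < 2 ^ (K + 1) / Real.sqrt ρ := this
      _ = 2 * (1 / Real.sqrt ρ) * 2 ^ K := by rw [pow_succ]; ring

/-- **THE CASCADE ENGINE** (kernel): floor + cap + domination at one density ⇒ `HasGroundStateBEC v ρ`. -/
theorem hasGroundStateBEC_of_cascade {v : ℝ → ENNReal} {ρ : ℝ} (hρ : 0 < ρ) (hF : FloorAt v ρ)
    (hC : CapAt v ρ) (hD : DomAt v ρ) : HasGroundStateBEC v ρ := by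
  obtain ⟨x, hx0, hx1, c₁, hc₁, HC⟩ := hC
  obtain ⟨A, hA, q, hq0, hq1, c₂, hc₂, HD⟩ := hD
  -- the index `i₀` and the final constant
  obtain ⟨i₀, hi₀⟩ : ∃ i₀ : ℕ, A * q ^ i₀ ≤ (1 - q) / 4 := by
    have h1q : 0 < 1 - q := sub_pos.2 hq1
    obtain ⟨n, hn⟩ := exists_pow_lt_of_lt_one (show 0 < (1 - q) / (4 * A) by positivity) hq1
    refine ⟨n, ?_⟩
    have h := (mul_lt_mul_of_pos_left hn hA).le
    calc A * q ^ n ≤ A * ((1 - q) / (4 * A)) := h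
      _ = (1 - q) / 4 := by field_simp
  set cf : ℝ := 7 / 8 * (1 - x) ^ (2 * i₀) / 2 with hcf_def
  have hx' : 0 < 1 - x := sub_pos.2 hx1
  have hcf : 0 < cf := by positivity
  have HCθ := HC cf hcf
  set c : ℝ := min (min c₁ c₂) cf with hc_def
  have hc : 0 < c := lt_min (lt_min hc₁ hc₂) hcf
  refine ⟨c, hc, ?_⟩
  have hLev : ∀ᶠ N : ℕ in atTop, 1 / Real.sqrt ρ ≤ sideLength ρ N :=
    (tendsto_sideLength_atTop hρ).eventually_ge_atTop _
  filter_upwards [hF, HCθ, HD, hLev, eventually_gt_atTop 0] with N hFN hCN hDN hLN hNpos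
  obtain ⟨δ₁, hδ₁, H₁⟩ := hCN
  obtain ⟨δ₂, hδ₂, H₂⟩ := hDN
  set L := sideLength ρ N with hLdef
  have hL : 0 < L := sideLength_pos_of_pos hρ hNpos
  have hNr : (0 : ℝ) < N := by exact_mod_cast hNpos
  refine le_condensateNumber v (δ := min (min δ₁ δ₂) 1) (lt_min (lt_min hδ₁ hδ₂) one_pos) fun Ψ hΨ => ?_
  have hΨ₁ : energy v Ψ ≤ groundStateEnergy v N L + δ₁ :=
    hΨ.trans (add_le_add le_rfl ((min_le_left _ _).trans (min_le_left _ _)))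
  have hΨ₂ : energy v Ψ ≤ groundStateEnergy v N L + δ₂ :=
    hΨ.trans (add_le_add le_rfl ((min_le_left _ _).trans (min_le_right _ _)))
  have hΨ₃ : energy v Ψ ≤ groundStateEnergy v N L + 1 := hΨ.trans (add_le_add le_rfl (min_le_right _ _))
  -- a lower bound `ofReal (c' N) ≤ maxOccupation` with `c ≤ c'` suffices
  have finish : ∀ c' : ℝ, c ≤ c' → ENNReal.ofReal (c' * N) ≤ maxOccupation N Ψ.ψ →
      ENNReal.ofReal (c * N) ≤ maxOccupation N Ψ.ψ := fun c' hcc' h =>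
    (ENNReal.ofReal_le_ofReal (mul_le_mul_of_nonneg_right hcc' hNr.le)).trans h
  rcases H₁ Ψ hΨ₁ with hesc | hcap
  · exact finish c₁ ((min_le_left _ _).trans (min_le_left _ _)) hesc
  rcases H₂ Ψ hΨ₂ with hesc | hdom
  · exact finish c₂ ((min_le_left _ _).trans (min_le_right _ _)) hesc
  -- the pivot level and the floor there
  obtain ⟨K, hK1, hK2⟩ := exists_pivot hρ hLN
  have hfloor := hFN Ψ hΨ₃ K hK1 hK2
  -- pass to the real profile `a k := S_k.toReal / N`
  set S : ℕ → ENNReal := fun k => subSum N L k Ψ.ψ with hSdef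
  have hS_ne : ∀ k, S k ≠ ⊤ := fun k => subSum_ne_top hL k Ψ
  set a : ℕ → ℝ := fun k => (S k).toReal / N with hadef
  have haS : ∀ k, (S k).toReal = a k * N := fun k => by
    simp only [hadef]; field_simp
  -- floor in real form
  have hK : 7 / 8 ≤ a K := by
    have h := (ENNReal.ofReal_le_iff_le_toReal (hS_ne K)).1 hfloor
    rw [haS] at h
    have : 7 / 8 * (N : ℝ) ≤ a K * N := by linarith
    exact le_of_mul_le_mul_right this hNr
  -- cap in real form
  have hcap' : ∀ k, 1 ≤ k → k ≤ K → cf ≤ a k → (1 - x) * a k ≤ a (k - 1) := by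
    intro k hk1 _ hθ
    have hθN : ENNReal.ofReal (cf * N) ≤ S k := by
      rw [ENNReal.ofReal_le_iff_le_toReal (hS_ne k), haS]
      exact mul_le_mul_of_nonneg_right hθ hNr.le
    have h := hcap k hk1 hθN
    have h' := ENNReal.toReal_mono (hS_ne (k - 1)) h
    rw [ENNReal.toReal_mul, ENNReal.toReal_ofReal hx'.le] at h'
    change (1 - x) * (S k).toReal ≤ (S (k - 1)).toReal at h'
    rw [haS, haS] at h'
    have : ((1 - x) * a k) * N ≤ a (k - 1) * N := by linarith
    exact le_of_mul_le_mul_right this hNr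
  -- domination in real form
  have hdom' : ∀ k, 1 ≤ k → k ≤ K → (1 - A * (q ^ (K - k) + q ^ k)) * a k ≤ a (k - 1) := by
    intro k hk1 hkK
    have h := hdom K k hK1 hK2 hk1 hkK
    change S k ≤ S (k - 1) + ENNReal.ofReal (A * (q ^ (K - k) + q ^ k)) * S k at h
    have hAq : 0 ≤ A * (q ^ (K - k) + q ^ k) := by positivity
    have hfin : S (k - 1) + ENNReal.ofReal (A * (q ^ (K - k) + q ^ k)) * S k ≠ ⊤ :=
      ENNReal.add_ne_top.2 ⟨hS_ne _, ENNReal.mul_ne_top ENNReal.ofReal_ne_top (hS_ne _)⟩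
    have h' := ENNReal.toReal_mono hfin h
    rw [ENNReal.toReal_add (hS_ne _) (ENNReal.mul_ne_top ENNReal.ofReal_ne_top (hS_ne _)),
      ENNReal.toReal_mul, ENNReal.toReal_ofReal hAq, haS, haS] at h'
    have : ((1 - A * (q ^ (K - k) + q ^ k)) * a k) * N ≤ a (k - 1) * N := by nlinarith
    exact le_of_mul_le_mul_right this hNr
  -- the real cascade: good levels `i₀ ≤ K - k ∧ i₀ ≤ k` spend the two-sided budget, the `≤ 2 i₀` others are capped
  have hmain : cf ≤ a 0 := by
    classical
    have h := cascade_abstract (K := K) (n := 2 * i₀) (x := x) (θ := cf) (f := 7 / 8) a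
      (fun k => A * (q ^ (K - k) + q ^ k)) (fun k => i₀ ≤ K - k ∧ i₀ ≤ k) hx0.le hx1 (by norm_num) hK
      (fun k => by positivity) (two_sided_budget_le hA.le hq0.le hq1 hi₀) (bad_card_le K i₀) le_rfl
      (fun k hk1 hkK _ => hdom' k hk1 hkK) hcap'
    simpa [hcf_def] using h
  -- back to `ENNReal`: `S_0 ≥ cf N`, and `S_0 ≤ λ_max`
  have h0 : ENNReal.ofReal (cf * N) ≤ S 0 := by
    rw [ENNReal.ofReal_le_iff_le_toReal (hS_ne 0), haS]
    exact mul_le_mul_of_nonneg_right hmain hNr.le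
  exact finish cf (min_le_right _ _) (h0.trans (subSum_zero_le_maxOccupation hL Ψ.ψ))

/-- **support item PROVED**: `CascadeEngine`. -/
theorem cascadeEngine_holds : CascadeEngine := by
  rw [cascadeEngine_iff]
  intro v ρ hρ hF hC hD
  exact hasGroundStateBEC_of_cascade hρ hF hC hD

/-- **DECIDING THEOREM** (`glue.lean` verbatim): the floor, B, A and the engine decide the conjunct. -/
theorem bec_of_items (h₀ : DiluteFloor) (h₁ : RetentionCap) (h₂ : InfraredDomination) (h₃ : CascadeEngine) :
    _root_.BoseEinsteinCondensation := by
  intro v hv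
  obtain ⟨ρ₁, hρ₁, H₁⟩ := h₁ v hv
  obtain ⟨ρ₂, hρ₂, H₂⟩ := h₂ v hv
  obtain ⟨ρ₃, hρ₃, H₃⟩ := h₀ v hv 1 one_pos
  refine ⟨min (min ρ₁ ρ₂) ρ₃, lt_min (lt_min hρ₁ hρ₂) hρ₃, fun ρ hρ hρlt => ?_⟩
  have hlt₁ : ρ < ρ₁ := lt_of_lt_of_le hρlt ((min_le_left _ _).trans (min_le_left _ _))
  have hlt₂ : ρ < ρ₂ := lt_of_lt_of_le hρlt ((min_le_left _ _).trans (min_le_right _ _))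
  have hlt₃ : ρ < ρ₃ := lt_of_lt_of_le hρlt (min_le_right _ _)
  exact h₃ v ρ hρ (H₃ ρ hρ hlt₃) (H₁ ρ hρ hlt₁) (H₂ ρ hρ hlt₂)

/-- DECIDING THEOREM, KERNEL FORM (engine discharged): floor, B, A. -/
theorem closes_kernel (h₀ : DiluteFloor) (h₁ : RetentionCap) (h₂ : InfraredDomination) :
    _root_.BoseEinsteinCondensation :=
  closes h₀ h₁ h₂ cascadeEngine_holds

/-- **The assembly item `Assembly`, BY NAME.** -/
theorem assembly_holds : Assembly := bec_of_items

end Sufficiency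

section Necessity
open Literature.MathematicalPhysics.QuantumManyBody.BoseGas

/-- Unpacking `HasGroundStateBEC`: some tolerance forces `λ_max ≥ (c/2)N` on every near-minimiser. -/
theorem escapeAt_of_hasGroundStateBEC {v : ℝ → ENNReal} {ρ : ℝ} (hB : HasGroundStateBEC v ρ) :
    EscapeAt v ρ := by
  obtain ⟨c, hc, hev⟩ := hB
  refine ⟨c / 2, by positivity, ?_⟩
  filter_upwards [hev, eventually_gt_atTop 0] with N hN hNpos
  have hNr : (0 : ℝ) < N := by exact_mod_cast hNpos
  have hcN : ENNReal.ofReal (c / 2 * N) < ENNReal.ofReal (c * N) := by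
    rw [ENNReal.ofReal_lt_ofReal_iff (by positivity)]
    nlinarith
  have hlt : ENNReal.ofReal (c / 2 * N) < condensateNumber v N (sideLength ρ N) := lt_of_lt_of_le hcN hN
  unfold condensateNumber at hlt
  obtain ⟨δ, hδ'⟩ := lt_iSup_iff.1 hlt
  obtain ⟨hδ, hδΨ⟩ := lt_iSup_iff.1 hδ'
  refine ⟨δ, hδ, fun Ψ hΨ => ?_⟩
  exact (lt_of_lt_of_le hδΨ ((iInf_le _ Ψ).trans (iInf_le _ hΨ))).le

/-- NECESSITY of the cap at one density (via the escape disjunct). -/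
theorem capAt_of_hasGroundStateBEC {v : ℝ → ENNReal} {ρ : ℝ} (hB : HasGroundStateBEC v ρ) : CapAt v ρ := by
  obtain ⟨c₀, hc₀, hev⟩ := escapeAt_of_hasGroundStateBEC hB
  refine ⟨1 / 2, by norm_num, by norm_num, c₀, hc₀, fun θ _ => ?_⟩
  filter_upwards [hev] with N hN
  obtain ⟨δ, hδ, H⟩ := hN
  exact ⟨δ, hδ, fun Ψ hΨ => Or.inl (H Ψ hΨ)⟩

/-- NECESSITY of the domination law at one density (via the escape disjunct). -/
theorem domAt_of_hasGroundStateBEC {v : ℝ → ENNReal} {ρ : ℝ} (hB : HasGroundStateBEC v ρ) : DomAt v ρ := by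
  obtain ⟨c₀, hc₀, hev⟩ := escapeAt_of_hasGroundStateBEC hB
  refine ⟨1, one_pos, 1 / 2, by norm_num, by norm_num, c₀, hc₀, ?_⟩
  filter_upwards [hev] with N hN
  obtain ⟨δ, hδ, H⟩ := hN
  exact ⟨δ, hδ, fun Ψ hΨ => Or.inl (H Ψ hΨ)⟩

/-- **NECESSITY of B** (kernel, unconditional). -/
theorem retentionCap_of_bec (hB : _root_.BoseEinsteinCondensation) : RetentionCap := by
  intro v hv
  obtain ⟨ρ₀, hρ₀, H⟩ := hB v hv
  exact ⟨ρ₀, hρ₀, fun ρ hρ hρlt => capAt_of_hasGroundStateBEC (H ρ hρ hρlt)⟩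

/-- **NECESSITY of A** (kernel, unconditional). -/
theorem infraredDomination_of_bec (hB : _root_.BoseEinsteinCondensation) : InfraredDomination := by
  intro v hv
  obtain ⟨ρ₀, hρ₀, H⟩ := hB v hv
  exact ⟨ρ₀, hρ₀, fun ρ hρ hρlt => domAt_of_hasGroundStateBEC (H ρ hρ hρlt)⟩

/-- **EXACTNESS** (kernel): modulo the proved Literature floor, the node is an exact decomposition. -/
theorem bec_iff_node (h₀ : DiluteFloor) : _root_.BoseEinsteinCondensation ↔ (RetentionCap ∧ InfraredDomination) :=
  ⟨fun h => ⟨retentionCap_of_bec h, infraredDomination_of_bec h⟩, fun h => closes_kernel h₀ h.1 h.2⟩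

/-- Per density: BEC at `ρ` ⟺ floor-fed cascade at `ρ` (given the floor at `ρ`). -/
theorem hasGroundStateBEC_iff_cascade {v : ℝ → ENNReal} {ρ : ℝ} (hρ : 0 < ρ) (hF : FloorAt v ρ) :
    HasGroundStateBEC v ρ ↔ (CapAt v ρ ∧ DomAt v ρ) :=
  ⟨fun h => ⟨capAt_of_hasGroundStateBEC h, domAt_of_hasGroundStateBEC h⟩,
    fun h => hasGroundStateBEC_of_cascade hρ hF h.1 h.2⟩

end Necessity

end Summit.AtomisticToContinuum.BoseEinsteinCondensation.Theorems.HealingPivotCascadeCascadeEngine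

end
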